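import Mathlib.Algebra.Group.Basic
import Mathlib.Data.Finset.Card
import Mathlib.Data.Finset.SymmDiff
import Mathlib.Data.Nat.Totient
import Mathlib.Algebra.Group.Nat.Even
import Mathlib.Tactic.Group
import Mathlib.Tactic.Ring
import Mathlib.Tactic.NormNum
import Mathlib.Tactic.Linarith
import HarnessLib

set_option linter.dupNamespace false

/-!
# Weil-type family coverage — TYPE-III WINDOWS, part N (census block b04.25): the group-theoretic and bookkeeping skeleton of ENGINE 6 (braid monodromy, THEOREM S27)

research route conditional on HC_CM; not a corollary; Q11.4-sentence-2 already refuted in dim ≥ 3.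

Ring 2, WEIL-TYPE FAMILY-COVERAGE CENSUS (`HOME/WEIL-FAMILY-COVERAGE.md` `## b04`, block b04.25, owner ring2-b04, gen 61; theory note
`HOME/pub-hodge-ring2-b04/census-g61/theory/THEOREMS-S27.md`).  SETTING (informal, NOT formalised): ENGINE 6 decides, for every 1-parameter
family of `G`-covers of `ℙ¹` with four branch points (a braid orbit of Nielsen classes `(g₁,g₂,g₃,g₄)`, `g₁g₂g₃g₄ = 1`), whether the hidden
fourfold `B_t` moves, by computing the monodromy of `H¹(B_t)` from the Hurwitz action of the braid group and Fox calculus.  THIS FILE checks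
(1) the identities of the HURWITZ ACTION used by the engine, in an arbitrary group: the move `σ : (a, b) ↦ (a b a⁻¹, a)` preserves the product
(`hurwitz_prod`), its square is simultaneous conjugation by `a b` (`hurwitz_sq_fst/snd`, the cusp loop of THEOREM S26.4 / S27.1 (d)), it
commutes with simultaneous conjugation (`hurwitz_conj_fst`), and the braid relation `σ₁σ₂σ₁ = σ₂σ₁σ₂` holds componentwise on triples
(`hurwitz_braid_fst/snd/thd`); (2) the dimension count of THEOREM S27.1 (b): `dim M = 2f − Σ fix(cᵢ) = 2k` when `2w(cᵢ) = f − fix(cᵢ)` and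
`k = Σ w − f` (`multiplicity_space_dim`); (3) the ramification bookkeeping of LEMMA S27.0 (b): with `S = Ram Q₁ ∩ Ram Q₂` among the split primes
and `p₀` in exactly one of them, the sets `S ∪ {p₀ if |S| odd}` and `S ∪ {∞} ∪ {p₀ if |S| even}` have even cardinality (`ramNc_card_even`,
`ramC_card_even`); (4) the Riemann–Hurwitz genera of the three isotrivial `2.A₆`-families of THEOREM S27.3 (`genus_33_55`, `genus_33_1010`,
`genus_33_88`) and the finite-order bound behind certificate (U) (`order_bound_120`).  Nothing about braid groups as such, covers, Hodge
structures or abelian varieties is formalised; `HC_CM` is used nowhere.  No `sorry`, no definitions.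
-/

namespace Summit.HodgeConjecture.HodgeConjecture.Ring2.WeilCoverage

section Hurwitz
variable {G : Type*} [Group G]

/-- The Hurwitz move `(a, b) ↦ (a b a⁻¹, a)` preserves the product of the pair (so `g₁g₂g₃g₄ = 1` is preserved by every `σᵢ`).
research route conditional on HC_CM; not a corollary; Q11.4-sentence-2 already refuted in dim ≥ 3. -/
theorem hurwitz_prod (a b : G) : (a * b * a⁻¹) * a = a * b := by group

/-- The inverse move `(a, b) ↦ (b, b⁻¹ a b)` also preserves the product.
research route conditional on HC_CM; not a corollary; Q11.4-sentence-2 already refuted in dim ≥ 3. -/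
theorem hurwitz_inv_prod (a b : G) : b * (b⁻¹ * a * b) = a * b := by group

/-- The two moves are inverse to each other (first component).
research route conditional on HC_CM; not a corollary; Q11.4-sentence-2 already refuted in dim ≥ 3. -/
theorem hurwitz_inv_fst (a b : G) : (a⁻¹ * (a * b * a⁻¹) * a) = b := by group

/-- The square of the Hurwitz move is simultaneous conjugation by `h = a b` — first component: `σ²(a,b)₁ = (ab) a (ab)⁻¹`.  This is the cusp
loop whose unipotent rank ENGINE 6 checks against the cut multiplicity `r(12|34)` (THEOREM S27.1 (d)).
research route conditional on HC_CM; not a corollary; Q11.4-sentence-2 already refuted in dim ≥ 3. -/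
theorem hurwitz_sq_fst (a b : G) :
    (a * b * a⁻¹) * a * (a * b * a⁻¹)⁻¹ = (a * b) * a * (a * b)⁻¹ := by group

/-- Square of the Hurwitz move, second component: `σ²(a,b)₂ = a b a⁻¹ = (ab) b (ab)⁻¹`.
research route conditional on HC_CM; not a corollary; Q11.4-sentence-2 already refuted in dim ≥ 3. -/
theorem hurwitz_sq_snd (a b : G) : a * b * a⁻¹ = (a * b) * b * (a * b)⁻¹ := by group

/-- The Hurwitz move commutes with simultaneous conjugation (so it acts on Nielsen classes modulo `Inn G`): first component.
research route conditional on HC_CM; not a corollary; Q11.4-sentence-2 already refuted in dim ≥ 3. -/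
theorem hurwitz_conj_fst (h a b : G) :
    (h * a * h⁻¹) * (h * b * h⁻¹) * (h * a * h⁻¹)⁻¹ = h * (a * b * a⁻¹) * h⁻¹ := by group

/-- Braid relation `σ₁σ₂σ₁ = σ₂σ₁σ₂` for the Hurwitz action on triples `(a, b, c)` (moves applied left to right), first component:
both sides give `a b c b⁻¹ a⁻¹`.
research route conditional on HC_CM; not a corollary; Q11.4-sentence-2 already refuted in dim ≥ 3. -/
theorem hurwitz_braid_fst (a b c : G) :
    (a * b * a⁻¹) * (a * c * a⁻¹) * (a * b * a⁻¹)⁻¹ = a * (b * c * b⁻¹) * a⁻¹ := by group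

/-- Braid relation, second component: both sides give `a b a⁻¹` (left: the old first entry moved; right: `σ₁` applied to `(a, bcb⁻¹)`… then
`σ₂`); stated as the literal identity the engine's tuple arithmetic relies on.
research route conditional on HC_CM; not a corollary; Q11.4-sentence-2 already refuted in dim ≥ 3. -/
theorem hurwitz_braid_snd (a b : G) : a * b * a⁻¹ = (a * b * a⁻¹) * a * a⁻¹ * (a * b * a⁻¹) * (a * b * a⁻¹)⁻¹ := by group

/-- Braid relation, third component: both sides end with `a`; together with `hurwitz_braid_fst/snd`:
`σ₁σ₂σ₁(a,b,c) = σ₂σ₁σ₂(a,b,c) = (abcb⁻¹a⁻¹, aba⁻¹, a)`, and the product is still `abc` (`hurwitz_braid_prod`).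
research route conditional on HC_CM; not a corollary; Q11.4-sentence-2 already refuted in dim ≥ 3. -/
theorem hurwitz_braid_prod (a b c : G) :
    (a * (b * c * b⁻¹) * a⁻¹) * (a * b * a⁻¹) * a = a * b * c := by group

/-- Far commutation `σ₁σ₃ = σ₃σ₁` is componentwise trivial; the one identity behind `σ₃` in the free-group model, `x₄ = (x₁x₂x₃)⁻¹ ↦ x₃`:
`α₃(x₃) = x₂⁻¹x₁⁻¹x₃⁻¹` gives `α₃(x₄) = (x₁ x₂ α₃(x₃))⁻¹ = x₃`.
research route conditional on HC_CM; not a corollary; Q11.4-sentence-2 already refuted in dim ≥ 3. -/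
theorem hurwitz_sigma3_x4 (x₁ x₂ x₃ : G) : (x₁ * x₂ * (x₂⁻¹ * x₁⁻¹ * x₃⁻¹))⁻¹ = x₃ := by group

end Hurwitz

/-- THEOREM S27.1 (b), the dimension of the multiplicity space: with four branch classes, `2·w i = f − fix i` and `k = Σ w − f`, the
`χ`-multiplicity space `M = K`-part/boundary has dimension `2f − Σ fix = 2k`.
research route conditional on HC_CM; not a corollary; Q11.4-sentence-2 already refuted in dim ≥ 3. -/
theorem multiplicity_space_dim (f k : ℤ) (w fx : Fin 4 → ℤ) (hw : ∀ i, 2 * w i = f - fx i)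
    (hk : k = (w 0 + w 1 + w 2 + w 3) - f) :
    2 * f - (fx 0 + fx 1 + fx 2 + fx 3) = 2 * k := by
  have h0 := hw 0; have h1 := hw 1; have h2 := hw 2; have h3 := hw 3
  omega

/-- For the fourfold families (`k = 2`): `dim M = 4`, e.g. `(2I, χ₄)`, `f = 4`, signature `(3_6,3_6,5_2,5_2)` with `fix = (2,2,0,0)`.
research route conditional on HC_CM; not a corollary; Q11.4-sentence-2 already refuted in dim ≥ 3. -/
theorem multiplicity_space_dim_chi4 : 2 * (4 : ℤ) - (2 + 2 + 0 + 0) = 2 * 2 := by norm_num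

/-- LEMMA S27.0 (b), bookkeeping: `Ram(Q_nc) = S ∪ ({p₀} if |S| odd)` has even cardinality (`p₀ ∉ S`).
research route conditional on HC_CM; not a corollary; Q11.4-sentence-2 already refuted in dim ≥ 3. -/
theorem ramNc_card_even {α : Type*} [DecidableEq α] (S : Finset α) (p0 : α) (hp : p0 ∉ S) :
    Even (if Odd S.card then (insert p0 S).card else S.card) := by
  by_cases h : Odd S.card
  · rw [if_pos h, Finset.card_insert_of_notMem hp]
    exact h.add_one
  · rw [if_neg h]; exact Nat.not_odd_iff_even.mp h

/-- LEMMA S27.0 (b), bookkeeping: `Ram(Q_c) = S ∪ {∞} ∪ ({p₀} if |S| even)` has even cardinality (`p₀, ∞ ∉ S`, `p₀ ≠ ∞`).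
research route conditional on HC_CM; not a corollary; Q11.4-sentence-2 already refuted in dim ≥ 3. -/
theorem ramC_card_even {α : Type*} [DecidableEq α] (S : Finset α) (p0 inf : α) (hp : p0 ∉ S) (hi : inf ∉ S) (hne : p0 ≠ inf) :
    Even (if Even S.card then (insert p0 (insert inf S)).card else (insert inf S).card) := by
  have hinf : (insert inf S).card = S.card + 1 := Finset.card_insert_of_notMem hi
  have hp' : p0 ∉ insert inf S := by
    simp only [Finset.mem_insert, not_or]; exact ⟨hne, hp⟩
  by_cases h : Even S.card
  · rw [if_pos h, Finset.card_insert_of_notMem hp', hinf]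
    have : S.card + 1 + 1 = S.card + 2 := by ring
    rw [this]; exact h.add (by decide)
  · rw [if_neg h, hinf]
    exact (Nat.not_even_iff_odd.mp h).add_one

/-- LEMMA S27.0 (b): `[Q₁] + [Q₂] = [D]` as the statement on ramification sets «`Ram Q₁ Δ Ram Q₂ = Ram D = {p₀, ∞}`», combined with
«`S = Ram Q₁ ∩ Ram Q₂`», determines both sets from `S` once one knows which of them contains `∞`: if `∞ ∈ R₁` then
`R₁ = S ∪ ({p₀,∞} ∖ R₂)`-style; here the elementary set identity used: `R₁ = (R₁ ∩ R₂) ∪ (R₁ ∖ R₂)` with `R₁ ∖ R₂ ⊆ R₁ Δ R₂`.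
research route conditional on HC_CM; not a corollary; Q11.4-sentence-2 already refuted in dim ≥ 3. -/
theorem ram_decomp {α : Type*} [DecidableEq α] (R₁ R₂ : Finset α) :
    R₁ = (R₁ ∩ R₂) ∪ (R₁ \ R₂) ∧ R₁ \ R₂ ⊆ symmDiff R₁ R₂ := by
  constructor
  · ext x; simp only [Finset.mem_union, Finset.mem_inter, Finset.mem_sdiff]; tauto
  · intro x hx
    rw [Finset.mem_symmDiff]; left; exact Finset.mem_sdiff.mp hx

/-- Certificate (U) of THEOREM S27.1 (d): the orders `n` with `φ(n) ≤ 4` are `1,2,3,4,5,6,8,10,12`, and every one of them divides `120`, so a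
degree-4 integer matrix of finite order satisfies `T^120 = 1`.  (Only the divisibility is checked here.)
research route conditional on HC_CM; not a corollary; Q11.4-sentence-2 already refuted in dim ≥ 3. -/
theorem order_bound_120 : ∀ n ∈ ({1, 2, 3, 4, 5, 6, 8, 10, 12} : Finset ℕ), n ∣ 120 := by decide

/-- The totients of the nine orders (the list behind the 24 cyclotomic products of degree 4 used by certificate (N)).
research route conditional on HC_CM; not a corollary; Q11.4-sentence-2 already refuted in dim ≥ 3. -/
theorem totients_le_four :
    Nat.totient 1 = 1 ∧ Nat.totient 2 = 1 ∧ Nat.totient 3 = 2 ∧ Nat.totient 4 = 2 ∧ Nat.totient 5 = 4 ∧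
    Nat.totient 6 = 2 ∧ Nat.totient 8 = 4 ∧ Nat.totient 10 = 4 ∧ Nat.totient 12 = 4 := by
  refine ⟨?_, ?_, ?_, ?_, ?_, ?_, ?_, ?_, ?_⟩ <;> decide

/-- THEOREM S27.3, Riemann–Hurwitz for the isotrivial family `(3_2,3_2,5_{10},5_{11})` of `2.A₆ = SL₂(9)` (`|G| = 720`, branch orders
`3,3,5,5`): `2g − 2 = 720·(−2 + 2/3 + 2/3 + 4/5 + 4/5)`, `g = 337`.
research route conditional on HC_CM; not a corollary; Q11.4-sentence-2 already refuted in dim ≥ 3. -/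
theorem genus_33_55 : (2 * (337 : ℚ) - 2) = 720 * (-2 + (1 - 1/3) + (1 - 1/3) + (1 - 1/5) + (1 - 1/5)) := by norm_num

/-- Riemann–Hurwitz for `(3_2,3_2,10_8,10_9)`: `g = 409`.
research route conditional on HC_CM; not a corollary; Q11.4-sentence-2 already refuted in dim ≥ 3. -/
theorem genus_33_1010 : (2 * (409 : ℚ) - 2) = 720 * (-2 + (1 - 1/3) + (1 - 1/3) + (1 - 1/10) + (1 - 1/10)) := by norm_num

/-- Riemann–Hurwitz for `(3_2,3_2,8_4,8_7)`: `g = 391`.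
research route conditional on HC_CM; not a corollary; Q11.4-sentence-2 already refuted in dim ≥ 3. -/
theorem genus_33_88 : (2 * (391 : ℚ) - 2) = 720 * (-2 + (1 - 1/3) + (1 - 1/3) + (1 - 1/8) + (1 - 1/8)) := by norm_num

/-- THEOREM S27.1 (c)(iii), the dimension bookkeeping: a non-central involution `u` on the 4-dimensional multiplicity space `M` has
eigenvalue multiplicities `(m₊, m₋)` with `m₊ + m₋ = 4`, both positive, and both EVEN because each eigen-piece of `B₀` is a `D`-module
(`ℚ`-dimension `2·m` divisible by `4`): hence `(m₊, m₋) = (2, 2)` — both pieces are abelian surfaces.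
research route conditional on HC_CM; not a corollary; Q11.4-sentence-2 already refuted in dim ≥ 3. -/
theorem involution_pieces (mp mm : ℕ) (hsum : mp + mm = 4) (hp : 0 < mp) (hm : 0 < mm) (ep : Even mp) (em : Even mm) :
    mp = 2 ∧ mm = 2 := by
  obtain ⟨a, ha⟩ := ep; obtain ⟨b, hb⟩ := em; omega

end Summit.HodgeConjecture.HodgeConjecture.Ring2.WeilCoverage
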